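import Summits.AtomisticToContinuum.HydrodynamicLimit.Theses.AnosovDiceHopf
import Summits.AtomisticToContinuum.HydrodynamicLimit.Theorems.StiffCollisionalRelaxationAprioriBoundsMesoPairDecorrelationDockTools
import Summits.AtomisticToContinuum.HydrodynamicLimit.Theorems.StiffCollisionalRelaxationAprioriBoundsEntropyRange
import Summits.AtomisticToContinuum.HydrodynamicLimit.Theorems.StiffCollisionalRelaxationAprioriBoundsMesoPairDecorrelationGlue
import HarnessLib

/-!
# The one-body dock of the stub `occupationVariance` / `pairDecorrelation`
(line `meso-chebyshev-window`, crux `AprioriBounds`, stmt-AtomisticToContinuum-14827), part 2: the dock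

Supporting file (`--supports stmt-AtomisticToContinuum-14827`) of the lead prover of the line
`Cruxes/AprioriBounds/Lines/meso_chebyshev_window.lean` (lead c10, stub worker W3 of stub 6).  Companion of
`…MesoPairDecorrelationDockTools.lean` (§1–§3 there).

**THE DOCK** (`occupationVariance_of_maxwellianOneBodyInBand`): the LIVE route item
`AnosovDiceHopf.MaxwellianOneBodyInBand` (stmt-AtomisticToContinuum-17603 — the one-body local-Maxwellian law of large
numbers at every fixed Euler time `t < T`, for bounded continuous `ψ(x, v)`, in the packing band `ρσ³ < η₀`; OPEN, the
kinetic face of propagation of local equilibrium at fixed `σ`) IMPLIES the registered r2 statement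
`stub_occupationVariance` of the line VERBATIM (= the third hypothesis of the landed capstone
`AprioriBounds_of_KRC_GT_occupationVariance`, p147849): under the crux prefix, `Var_{P_N}(occ_K) → 0` for every `K`.
So the "one new item" of the D3 split of the crux is subsumed by stmt-17603: a FIXED-TIME ONE-PARTICLE LLN suffices,
no second-marginal / two-time input is needed; and the registered r3 stub `stub_pairDecorrelation` follows VERBATIM
(`pairDecorrelation_of_maxwellianOneBodyInBand`) by the landed converse `pairDecorrelation_of_occupationVariance`.

Chain of the proof:
* §4 `pdk_shell_mass_small`: the limiting local-Maxwellian mass `∫ρ_s ∫ h_ε(|v|²) M_{1,θ_s,u_s} dv dx` of the shell bump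
  of the sandwich is small for small `ε` (Maxwellian `≤ (2πθ)^{-3/2}`, shell volume `→ 0` by continuity from above down
  to the null sphere `|v|² = K`, `Measure.addHaar_sphere`);
* §5 `pdk_variance_frac_tendsto_zero`: an LLN in probability for bounded CONTINUOUS velocity statistics forces
  `Var_{P_N}(frac_K ∘ w_N) → 0` for the DISCONTINUOUS tail fraction (sandwich + `pdk_variance_le_of_sandwich`);
* §6 `fixedTimeTailVariance_of_maxwellianOneBodyInBand`: glue to the crux prefix exactly as the landed
  `AdiabatCeiling.stub_velocityLLN_of_maxwellianOneBodyInBand` (chamber `2ρσ³ < η₀` on `[0,t]` ⟹ band on some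
  `[0,t')`, `exists_chamber_extension`; restrict the solution; `σ₀ ⊓ 1/2` for probability laws), then
  `occupationVariance_of_fixedTimeTailVariance` (part 1).

No new definitions, no named facts; axioms `propext`, `Classical.choice`, `Quot.sound`.
-/

noncomputable section

open MeasureTheory ProbabilityTheory Filter Set Topology
open scoped ENNReal

namespace Summit.AtomisticToContinuum.HydrodynamicLimit.Theorems.MesoChebyshevWindow

open Literature.MathematicalPhysics.KineticTheory Literature.Analysis.FluidPDE
open Summit.AtomisticToContinuum.HydrodynamicLimit.Theorems.VisitLedgerUpscattering (Cfg Flow Flows NiceProfiles)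
open Summit.AtomisticToContinuum.HydrodynamicLimit.Theorems.FibreDeficitTransfer

/-! ## §4 The limiting Maxwellian mass of a thin velocity shell -/

/-- **The limiting mass of a thin velocity shell is small.**  For a level `K`, continuous `ρx ≥ 0`, continuous
`θx > 0` and any `ux` on `𝕋³`, and every `η > 0`, there is `ε > 0` such that the local-Maxwellian mass of the
shell bump `h_ε(|v|²)` of `pdk_sandwich` is at most `η`:  `∫ ρx(x) ∫ h_ε(|v|²) M_{1,θx(x),ux(x)}(v) dv dx ≤ η`.
Proof: bound the Maxwellian by its prefactor `(2πθx(x))^{-3/2}` and the bump by the indicator of the shell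
`K − ε < |v|² < K + 2ε`, whose Lebesgue measure tends to `0` with `ε` (continuity from above down to the null
sphere `|v|² = K`, `Measure.addHaar_sphere`). -/
theorem pdk_shell_mass_small (K : ℝ) {ρx θx : T3 → ℝ} (ux : T3 → V3)
    (hρc : Continuous ρx) (hθc : Continuous θx) (hρ0 : ∀ x, 0 ≤ ρx x) (hθ0 : ∀ x, 0 < θx x)
    {η : ℝ} (hη : 0 < η) :
    ∃ ε : ℝ, 0 < ε ∧
      ∫ x, ρx x * ∫ v, (max 0 (min 1 ((‖v‖ ^ 2 - (K - ε)) / ε)) - max 0 (min 1 ((‖v‖ ^ 2 - (K + ε)) / ε))) *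
        localMaxwellian 1 (θx x) (ux x) v ≤ η := by
  -- the velocity-sup of the Maxwellian
  set Mbar : T3 → ℝ := fun x => (2 * Real.pi * θx x) ^ (-(Module.finrank ℝ V3 : ℝ) / 2) with hMbar
  have hMbar_nn : ∀ x, 0 ≤ Mbar x := fun x => by
    have := hθ0 x
    exact Real.rpow_nonneg (by positivity) _
  have hM_nn : ∀ x v, 0 ≤ localMaxwellian 1 (θx x) (ux x) v := fun x v =>
    localMaxwellian_nonneg zero_le_one (hθ0 x).le _ _
  have hM_le : ∀ x v, localMaxwellian 1 (θx x) (ux x) v ≤ Mbar x := by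
    intro x v
    have hθx := hθ0 x
    unfold localMaxwellian
    rw [one_mul]
    have hexp : Real.exp (-‖v - ux x‖ ^ 2 / (2 * θx x)) ≤ 1 :=
      Real.exp_le_one_iff.2 (div_nonpos_of_nonpos_of_nonneg (neg_nonpos.2 (sq_nonneg _)) (by positivity))
    calc (2 * Real.pi * θx x) ^ (-(Module.finrank ℝ V3 : ℝ) / 2) * Real.exp (-‖v - ux x‖ ^ 2 / (2 * θx x))
        ≤ Mbar x * 1 := mul_le_mul_of_nonneg_left hexp (hMbar_nn x)
      _ = Mbar x := mul_one _
  have hMbar_c : Continuous Mbar := by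
    refine Continuous.rpow_const (continuous_const.mul hθc) fun x => Or.inl ?_
    have := hθ0 x
    positivity
  -- `I := ∫ ρx · Mbar`
  set I : ℝ := ∫ x, ρx x * Mbar x with hI
  have hI0 : 0 ≤ I := integral_nonneg fun x => mul_nonneg (hρ0 x) (hMbar_nn x)
  -- the shells `S n = {K - 1/(n+1) < |v|² < K + 2/(n+1)}`
  set S : ℕ → Set V3 := fun n =>
    {v | K - 1 / ((n : ℝ) + 1) < ‖v‖ ^ 2 ∧ ‖v‖ ^ 2 < K + 2 * (1 / ((n : ℝ) + 1))} with hS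
  have hSmem : ∀ n v, v ∈ S n ↔
      K - 1 / ((n : ℝ) + 1) < ‖v‖ ^ 2 ∧ ‖v‖ ^ 2 < K + 2 * (1 / ((n : ℝ) + 1)) := fun n v => Iff.rfl
  have hSmeas : ∀ n, MeasurableSet (S n) := fun n =>
    (measurableSet_lt measurable_const (measurable_norm.pow_const 2)).inter
      (measurableSet_lt (measurable_norm.pow_const 2) measurable_const)
  have hSanti : Antitone S := by
    intro m n hmn v hv
    rw [hSmem] at hv ⊢
    have hmn' : (m : ℝ) + 1 ≤ (n : ℝ) + 1 := by
      have : (m : ℝ) ≤ n := by exact_mod_cast hmn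
      linarith
    have h1 : 1 / ((n : ℝ) + 1) ≤ 1 / ((m : ℝ) + 1) := one_div_le_one_div_of_le (by positivity) hmn'
    exact ⟨by linarith [hv.1], by linarith [hv.2]⟩
  have hSfin0 : volume (S 0) ≠ ∞ := by
    refine ne_top_of_le_ne_top (measure_ball_lt_top (μ := volume) (x := (0 : V3))
      (r := Real.sqrt (K + 2))).ne (measure_mono fun v hv => ?_)
    rw [hSmem] at hv
    rw [mem_ball_zero_iff]
    have h2 : ‖v‖ ^ 2 < K + 2 := by
      have := hv.2
      norm_num at this
      linarith
    exact (Real.lt_sqrt (norm_nonneg _)).2 h2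
  have hSfin : ∀ n, volume (S n) ≠ ∞ := fun n =>
    ne_top_of_le_ne_top hSfin0 (measure_mono (hSanti (Nat.zero_le n)))
  have hSlim : Tendsto (fun n => volume (S n)) atTop (𝓝 0) := by
    have h := tendsto_measure_iInter_atTop (μ := volume) (fun n => (hSmeas n).nullMeasurableSet) hSanti
      ⟨0, hSfin0⟩
    have hnull : volume (⋂ n, S n) = 0 := by
      refine measure_mono_null (fun v hv => ?_) (Measure.addHaar_sphere volume (0 : V3) (Real.sqrt K))
      rw [mem_iInter] at hv
      have hsq : ‖v‖ ^ 2 = K := by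
        refine le_antisymm (le_of_forall_pos_lt_add fun e he => ?_) (le_of_forall_pos_lt_add fun e he => ?_)
        · obtain ⟨n, hn⟩ := exists_nat_one_div_lt (half_pos he)
          have := ((hSmem n v).1 (hv n)).2
          linarith
        · obtain ⟨n, hn⟩ := exists_nat_one_div_lt he
          have := ((hSmem n v).1 (hv n)).1
          linarith
      rw [mem_sphere_zero_iff_norm, ← Real.sqrt_sq (norm_nonneg v), hsq]
    rw [hnull] at h
    exact h
  -- choose the shell
  have hev : ∀ᶠ n in atTop, volume (S n) < ENNReal.ofReal (η / (I + 1)) :=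
    hSlim.eventually (gt_mem_nhds (ENNReal.ofReal_pos.2 (by positivity)))
  obtain ⟨n, hn⟩ := hev.exists
  have hvol : (volume (S n)).toReal ≤ η / (I + 1) :=
    ENNReal.toReal_le_of_le_ofReal (by positivity) hn.le
  set ε : ℝ := 1 / ((n : ℝ) + 1) with hε
  have hεpos : 0 < ε := by positivity
  refine ⟨ε, hεpos, ?_⟩
  -- inner bound, for every `x`
  have hinner : ∀ x, ∫ v, (max 0 (min 1 ((‖v‖ ^ 2 - (K - ε)) / ε)) - max 0 (min 1 ((‖v‖ ^ 2 - (K + ε)) / ε))) *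
      localMaxwellian 1 (θx x) (ux x) v ≤ (volume (S n)).toReal * Mbar x := by
    intro x
    have hg : Integrable ((S n).indicator fun _ => Mbar x) (volume : Measure V3) :=
      (integrableOn_const (hSfin n)).integrable_indicator (hSmeas n)
    calc ∫ v, (max 0 (min 1 ((‖v‖ ^ 2 - (K - ε)) / ε)) - max 0 (min 1 ((‖v‖ ^ 2 - (K + ε)) / ε))) *
          localMaxwellian 1 (θx x) (ux x) v
        ≤ ∫ v, (S n).indicator (fun _ => Mbar x) v := by
          refine integral_mono_of_nonneg (Eventually.of_forall fun v => ?_) hg (Eventually.of_forall fun v => ?_)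
          · exact mul_nonneg (pdk_sandwich hεpos K (‖v‖ ^ 2)).2.2.2.1 (hM_nn x v)
          · by_cases hv : v ∈ S n
            · rw [indicator_of_mem hv]
              calc _ ≤ 1 * Mbar x :=
                    mul_le_mul (pdk_sandwich hεpos K (‖v‖ ^ 2)).2.2.1 (hM_le x v) (hM_nn x v) zero_le_one
                _ = Mbar x := one_mul _
            · rw [indicator_of_notMem hv]
              have hz := (pdk_sandwich hεpos K (‖v‖ ^ 2)).2.2.2.2 (by rwa [hSmem] at hv)
              beta_reduce
              rw [hz, zero_mul]
      _ = (volume (S n)).toReal * Mbar x := by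
          rw [integral_indicator_const _ (hSmeas n), smul_eq_mul, measureReal_def]
  -- outer bound
  have hcont : Continuous fun x => ρx x * ((volume (S n)).toReal * Mbar x) :=
    hρc.mul (continuous_const.mul hMbar_c)
  calc ∫ x, ρx x * ∫ v, (max 0 (min 1 ((‖v‖ ^ 2 - (K - ε)) / ε)) - max 0 (min 1 ((‖v‖ ^ 2 - (K + ε)) / ε))) *
        localMaxwellian 1 (θx x) (ux x) v
      ≤ ∫ x, ρx x * ((volume (S n)).toReal * Mbar x) := by
        refine integral_mono_of_nonneg (Eventually.of_forall fun x => ?_) hcont.integrable_unitAddTorus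
          (Eventually.of_forall fun x => mul_le_mul_of_nonneg_left (hinner x) (hρ0 x))
        exact mul_nonneg (hρ0 x) (integral_nonneg fun v =>
          mul_nonneg (pdk_sandwich hεpos K (‖v‖ ^ 2)).2.2.2.1 (hM_nn x v))
    _ = (volume (S n)).toReal * I := by
        rw [hI, ← integral_const_mul]
        refine integral_congr_ae (Eventually.of_forall fun x => ?_)
        simp only
        ring
    _ ≤ η / (I + 1) * I := mul_le_mul_of_nonneg_right hvol hI0
    _ ≤ η := by
        rw [div_mul_eq_mul_div, div_le_iff₀ (by positivity)]
        nlinarith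

/-! ## §5 Fixed-time tail-fraction variances from the one-body Maxwellian law of large numbers -/

/-- Averages of a velocity statistic against the empirical measure: `∫ g(v) dμ_w = (N+1)⁻¹ ∑ᵢ g(vᵢ)`. -/
theorem pdk_integral_empiricalMeasure_snd {N : ℕ} (g : V3 → ℝ) (w : Cfg N) :
    ∫ y, g y.2 ∂(empiricalMeasure w) = ((N + 1 : ℕ) : ℝ)⁻¹ * ∑ i, g (w i).2 := by
  rw [integral_empiricalMeasure]

/-- Monotonicity of empirical averages of velocity statistics. -/
theorem pdk_avg_le {N : ℕ} {g g' : V3 → ℝ} (h : ∀ v, g v ≤ g' v) (w : Cfg N) :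
    ((N + 1 : ℕ) : ℝ)⁻¹ * ∑ i, g (w i).2 ≤ ((N + 1 : ℕ) : ℝ)⁻¹ * ∑ i, g' (w i).2 :=
  mul_le_mul_of_nonneg_left (Finset.sum_le_sum fun i _ => h _) (inv_nonneg.2 (by positivity))

/-- The empirical average of the constant `1` is `1`. -/
theorem pdk_avg_one (N : ℕ) : ((N + 1 : ℕ) : ℝ)⁻¹ * ∑ _i : Fin (N + 1), (1 : ℝ) = 1 := by
  rw [Finset.sum_const, Finset.card_univ, Fintype.card_fin, nsmul_eq_mul, mul_one]
  exact inv_mul_cancel₀ (by positivity)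

/-- **Fixed-time tail-fraction variances vanish under a one-body Maxwellian LLN.**  Let `P_N` be probability laws on
`N + 1`-sphere phase space and `w_N` measurable maps of it (the flow at a fixed time).  If for every continuous
velocity statistic `g` with `|g| ≤ 1` the empirical average `∫ g(v) dμ_{w_N z}` converges in `P_N`-probability to
`∫ ρx(x) ∫ g(v) M_{1,θx(x),ux(x)}(v) dv dx` (`ρx ≥ 0`, `θx > 0` continuous), then for every level `K` the
variance of the tail fraction `frac_K(w_N z)` (the empirical mass of `{K ≤ |v|²}`, a DISCONTINUOUS statistic) tends
to `0`: sandwich the indicator between continuous ramps (`pdk_sandwich`), bound the variance by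
`pdk_variance_le_of_sandwich`, and make the limiting shell mass small by `pdk_shell_mass_small`. -/
theorem pdk_variance_frac_tendsto_zero (K : ℝ) {ρx θx : T3 → ℝ} {ux : T3 → V3}
    (hρc : Continuous ρx) (hθc : Continuous θx) (hρ0 : ∀ x, 0 ≤ ρx x) (hθ0 : ∀ x, 0 < θx x)
    (P : (N : ℕ) → Measure (Cfg N)) (hP : ∀ N, IsProbabilityMeasure (P N))
    (w : (N : ℕ) → Cfg N → Cfg N) (hw : ∀ N, Measurable (w N))
    (hlln : ∀ g : V3 → ℝ, Continuous g → (∀ v, |g v| ≤ 1) → ∀ δ : ℝ, 0 < δ →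
      Tendsto (fun N : ℕ => P N {z | δ < |(∫ y, g y.2 ∂(empiricalMeasure (w N z))) -
        ∫ x, ρx x * ∫ v, g v * localMaxwellian 1 (θx x) (ux x) v|}) atTop (𝓝 0)) :
    Tendsto (fun N : ℕ => variance (fun z => frac K (w N z)) (P N)) atTop (𝓝 0) := by
  rw [Metric.tendsto_atTop]
  intro η hη
  -- a shell bump with small limiting mass
  obtain ⟨ε, hε, hmass⟩ := pdk_shell_mass_small K ux hρc hθc hρ0 hθ0 (show (0 : ℝ) < η / 16 by positivity)
  set gm : V3 → ℝ := fun v => max 0 (min 1 ((‖v‖ ^ 2 - K) / ε)) with hgm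
  set gY : V3 → ℝ := fun v =>
    max 0 (min 1 ((‖v‖ ^ 2 - (K - ε)) / ε)) - max 0 (min 1 ((‖v‖ ^ 2 - (K + ε)) / ε)) with hgY
  have hr : Continuous fun v : V3 => ‖v‖ ^ 2 := continuous_norm.pow 2
  have hgm_c : Continuous gm := pdk_continuous_clamp.comp ((hr.sub continuous_const).div_const ε)
  have hgY_c : Continuous gY :=
    (pdk_continuous_clamp.comp ((hr.sub continuous_const).div_const ε)).sub
      (pdk_continuous_clamp.comp ((hr.sub continuous_const).div_const ε))
  have hgm01 : ∀ v, gm v ∈ Icc (0 : ℝ) 1 := fun v => ⟨le_max_left _ _, max_le zero_le_one (min_le_left _ _)⟩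
  have hgm_b : ∀ v, |gm v| ≤ 1 := fun v => abs_le.2 ⟨by linarith [(hgm01 v).1], (hgm01 v).2⟩
  have hgY_b : ∀ v, |gY v| ≤ 1 := fun v => by
    have h := pdk_sandwich hε K (‖v‖ ^ 2)
    exact abs_le.2 ⟨by linarith [h.2.2.2.1], h.2.2.1⟩
  set mm : ℝ := ∫ x, ρx x * ∫ v, gm v * localMaxwellian 1 (θx x) (ux x) v with hmm
  set mY : ℝ := ∫ x, ρx x * ∫ v, gY v * localMaxwellian 1 (θx x) (ux x) v with hmY
  have hmY0 : 0 ≤ mY := integral_nonneg fun x => mul_nonneg (hρ0 x) (integral_nonneg fun v =>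
    mul_nonneg (pdk_sandwich hε K (‖v‖ ^ 2)).2.2.2.1 (localMaxwellian_nonneg zero_le_one (hθ0 x).le _ _))
  have hmYle : mY ≤ η / 16 := hmass
  set δ : ℝ := min (η / 16) 1 with hδ
  have hδpos : 0 < δ := lt_min (by positivity) one_pos
  have hδle : δ ≤ η / 16 := min_le_left _ _
  have hδsq : δ ^ 2 ≤ δ := by
    have h1 : δ ≤ 1 := min_le_right _ _
    nlinarith
  -- the two bad events have vanishing probability
  have hr1 := (ENNReal.tendsto_toReal ENNReal.zero_ne_top).comp (hlln gY hgY_c hgY_b δ hδpos)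
  have hr2 := ((ENNReal.tendsto_toReal ENNReal.zero_ne_top).comp (hlln gm hgm_c hgm_b δ hδpos)).const_mul
    ((1 + |mm|) ^ 2)
  rw [ENNReal.toReal_zero] at hr1 hr2
  rw [mul_zero] at hr2
  have he1 := hr1.eventually (gt_mem_nhds (show (0 : ℝ) < η / 16 by positivity))
  have he2 := hr2.eventually (gt_mem_nhds (show (0 : ℝ) < η / 16 by positivity))
  obtain ⟨N₀, hN₀⟩ := eventually_atTop.1 (he1.and he2)
  refine ⟨N₀, fun N hN => ?_⟩
  obtain ⟨h1N, h2N⟩ := hN₀ N hN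
  simp only [Function.comp_apply] at h1N h2N
  haveI := hP N
  -- measurability of the three statistics
  have hmeas_avg : ∀ g : V3 → ℝ, Continuous g →
      Measurable fun z => ∫ y, g y.2 ∂(empiricalMeasure (w N z)) := by
    intro g hg
    have h : (fun z => ∫ y, g y.2 ∂(empiricalMeasure (w N z))) =
        fun z => ((N + 1 : ℕ) : ℝ)⁻¹ * ∑ i, g ((w N z i).2) :=
      funext fun z => pdk_integral_empiricalMeasure_snd g (w N z)
    rw [h]
    exact measurable_const.mul (Finset.measurable_sum _ fun i _ =>
      hg.measurable.comp ((measurable_pi_apply i).comp (hw N)).snd)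
  have hXmeas : Measurable fun z => frac K (w N z) := (measurable_frac K).comp (hw N)
  -- the pointwise sandwich
  have hdiff : ∀ z, frac K (w N z) - ∫ y, gm y.2 ∂(empiricalMeasure (w N z)) =
      ((N + 1 : ℕ) : ℝ)⁻¹ *
        ∑ i, ((if K ≤ ‖((w N z) i).2‖ ^ 2 then (1 : ℝ) else 0) - gm ((w N z) i).2) := by
    intro z
    rw [frac_eq_avg, pdk_integral_empiricalMeasure_snd, ← mul_sub, Finset.sum_sub_distrib]
  have h0 : ∀ z, 0 ≤ frac K (w N z) - ∫ y, gm y.2 ∂(empiricalMeasure (w N z)) := fun z => by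
    rw [hdiff]
    exact mul_nonneg (inv_nonneg.2 (by positivity)) (Finset.sum_nonneg fun i _ => (pdk_sandwich hε K _).1)
  have h1 : ∀ z, frac K (w N z) - ∫ y, gm y.2 ∂(empiricalMeasure (w N z)) ≤
      ∫ y, gY y.2 ∂(empiricalMeasure (w N z)) := fun z => by
    rw [hdiff, pdk_integral_empiricalMeasure_snd]
    exact mul_le_mul_of_nonneg_left (Finset.sum_le_sum fun i _ => (pdk_sandwich hε K _).2.1)
      (inv_nonneg.2 (by positivity))
  have hY1 : ∀ z, ∫ y, gY y.2 ∂(empiricalMeasure (w N z)) ≤ 1 := fun z => by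
    rw [pdk_integral_empiricalMeasure_snd]
    exact (pdk_avg_le (fun v => (pdk_sandwich hε K (‖v‖ ^ 2)).2.2.1) (w N z)).trans (pdk_avg_one N).le
  have hXm1 : ∀ z, |∫ y, gm y.2 ∂(empiricalMeasure (w N z))| ≤ 1 := fun z => by
    rw [pdk_integral_empiricalMeasure_snd, abs_le]
    constructor
    · have h := mul_nonneg (inv_nonneg.2 (by positivity : (0 : ℝ) ≤ ((N + 1 : ℕ) : ℝ)))
        (Finset.sum_nonneg fun i (_ : i ∈ Finset.univ) => (hgm01 ((w N z) i).2).1)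
      linarith
    · exact (pdk_avg_le (fun v => (hgm01 v).2) (w N z)).trans (pdk_avg_one N).le
  have hbound := pdk_variance_le_of_sandwich (P N) hXmeas (hmeas_avg gm hgm_c) (hmeas_avg gY hgY_c)
    h0 h1 hY1 hXm1 mm hmY0 hδpos
  rw [Real.dist_eq, sub_zero, abs_of_nonneg (variance_nonneg _ _)]
  refine hbound.trans_lt ?_
  rw [measureReal_def, measureReal_def]
  nlinarith [h1N, h2N, hmYle, hδle, hδsq, hη]

/-! ## §6 The dock, in the crux prefix -/

/-- **Fixed-time tail-fraction variances vanish, from `AnosovDiceHopf.MaxwellianOneBodyInBand`**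
(stmt-AtomisticToContinuum-17603).  Under the crux prefix of `AprioriBounds` (with `η₁ := η₀`, the item's packing
band, and `σ₀ ≤ 1/2` so that the local Gibbs laws are probability measures), for every level `K` and every FIXED
`s ∈ [0, t]`, `Var_{P_N}(frac_K ∘ Φ^N_s) → 0`.  Glue: the chamber `2ρσ³ < η₀` on `[0, t]` gives the band on some
`[0, t')`, `t < t' ≤ T` (`exists_chamber_extension`); the item is applied to the restricted solution at the time `s`
with velocity statistics `ψ(x, v) = g(v)` (`pdk_variance_frac_tendsto_zero`). -/
theorem fixedTimeTailVariance_of_maxwellianOneBodyInBand :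
    Summit.AtomisticToContinuum.HydrodynamicLimit.Theses.AnosovDiceHopf.MaxwellianOneBodyInBand →
    ∀ (a₀ θ₀ : T3 → ℝ) (u₀ : T3 → V3), Continuous a₀ → Continuous θ₀ → Continuous u₀ →
      (∀ x, 0 < a₀ x) → (∀ x, 0 < θ₀ x) →
      ∃ σ₀ : ℝ, 0 < σ₀ ∧ ∃ η₁ : ℝ, 0 < η₁ ∧ ∀ σ : ℝ, 0 < σ → σ < σ₀ →
        ∀ (T : ℝ) (ρ θ : ℝ → T3 → ℝ) (u : ℝ → T3 → V3), IsHardSphereEulerSolution σ T ρ u θ →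
        ∀ Φ : (N : ℕ) → HardSphereFlow (Torus.geometry (Fin 3)) (hsDiameter σ N) (N + 1),
          TendstoHydroFieldsAt (fun N => localGibbsLaw σ a₀ u₀ θ₀ N (Φ N)) Φ ρ u θ 0 →
          ∀ t : ℝ, 0 < t → t < T → (∀ s ∈ Icc 0 t, ∀ x, 2 * ρ s x * σ ^ 3 < η₁) →
            ∀ K : ℝ, ∀ s ∈ Icc 0 t, Tendsto (fun N : ℕ => variance (fun z => frac K ((Φ N).flow s z))
              (localGibbsLaw σ a₀ u₀ θ₀ N (Φ N))) atTop (𝓝 0) := by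
  rintro ⟨η₀, hη₀, h⟩ a₀ θ₀ u₀ ha hθ hu ha0 hθ0
  obtain ⟨σ₀, hσ₀, hmain⟩ := h a₀ θ₀ u₀ ha hθ hu ha0 hθ0
  refine ⟨min σ₀ (1 / 2), lt_min hσ₀ one_half_pos, η₀, hη₀, ?_⟩
  intro σ hσ hσlt T ρ θ u hsol Φ h0 t ht htT hchamber K s hs
  have hσσ₀ : σ < σ₀ := hσlt.trans_le (min_le_left _ _)
  have hσ2 : σ ≤ 1 / 2 := (hσlt.trans_le (min_le_right _ _)).le
  -- the chamber puts `[0, t]` in the band; extend past `t` and restrict the solution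
  have hband : ∀ s' ∈ Icc 0 t, ∀ x, ρ s' x * σ ^ 3 < η₀ := fun s' hs' x => by
    have h2 := hchamber s' hs' x
    rcases le_or_gt 0 (ρ s' x * σ ^ 3) with hnn | hneg
    · linarith
    · exact hneg.trans hη₀
  obtain ⟨t', htt', ht'T, hband'⟩ := AdiabatCeiling.exists_chamber_extension hsol hσ ht.le htT hband
  have hsT : s ∈ Ico 0 T := ⟨hs.1, hs.2.trans_lt htT⟩
  -- the one-body Maxwellian LLN at the time `s`, for velocity statistics `ψ(x, v) = g(v)`
  refine pdk_variance_frac_tendsto_zero K (ρx := ρ s) (θx := θ s) (ux := u s)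
    (hsol.smooth_density.isSmooth_slice hsT).continuous (hsol.smooth_temperature.isSmooth_slice hsT).continuous
    (fun x => (hsol.density_pos s hsT x).le) (fun x => hsol.temperature_pos s hsT x)
    (fun N => localGibbsLaw σ a₀ u₀ θ₀ N (Φ N))
    (fun N => isProbabilityMeasure_localGibbsLaw ha hθ hu ha0 hθ0 hσ2 N (Φ N))
    (fun N => (Φ N).flow s) (fun N => (Φ N).measurable_flow s) ?_
  intro g hg hgb δ hδ
  exact hmain σ hσ hσσ₀ t' ρ θ u (hsol.restrict ht'T) hband' Φ h0 s ⟨hs.1, hs.2.trans_lt htt'⟩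
    (fun y => g y.2) (hg.comp continuous_snd) ⟨1, fun y => hgb y.2⟩ δ hδ

/-- **THE DOCK.**  `AnosovDiceHopf.MaxwellianOneBodyInBand` (stmt-AtomisticToContinuum-17603, the LIVE one-body
local-Maxwellian law of large numbers at fixed Euler times, in the packing band) IMPLIES the registered statement
`stub_occupationVariance` of the line `meso-chebyshev-window` VERBATIM (the r2 text of stub 6, = the third
hypothesis of the landed capstone `AprioriBounds_of_KRC_GT_occupationVariance`): under the crux prefix, for every
fixed level `K`, `Var_{P_N}(occ_K) → 0`, `occ_K(z) = ∫₀ᵗ frac_K(Φ_s z) ds`.  Chain: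
`fixedTimeTailVariance_of_maxwellianOneBodyInBand` (fixed-time LLN ⟹ fixed-time variances of the bounded,
sandwiched tail fraction vanish) then `occupationVariance_of_fixedTimeTailVariance` (Cauchy–Schwarz in time). -/
theorem occupationVariance_of_maxwellianOneBodyInBand :
    Summit.AtomisticToContinuum.HydrodynamicLimit.Theses.AnosovDiceHopf.MaxwellianOneBodyInBand →
    ∀ (a₀ θ₀ : T3 → ℝ) (u₀ : T3 → V3), Continuous a₀ → Continuous θ₀ → Continuous u₀ →
      (∀ x, 0 < a₀ x) → (∀ x, 0 < θ₀ x) →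
      ∃ σ₀ : ℝ, 0 < σ₀ ∧ ∃ η₁ : ℝ, 0 < η₁ ∧ ∀ σ : ℝ, 0 < σ → σ < σ₀ →
        ∀ (T : ℝ) (ρ θ : ℝ → T3 → ℝ) (u : ℝ → T3 → V3), IsHardSphereEulerSolution σ T ρ u θ →
        ∀ Φ : (N : ℕ) → HardSphereFlow (Torus.geometry (Fin 3)) (hsDiameter σ N) (N + 1),
          TendstoHydroFieldsAt (fun N => localGibbsLaw σ a₀ u₀ θ₀ N (Φ N)) Φ ρ u θ 0 →
          ∀ t : ℝ, 0 < t → t < T → (∀ s ∈ Icc 0 t, ∀ x, 2 * ρ s x * σ ^ 3 < η₁) →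
            ∀ K : ℝ, Tendsto (fun N : ℕ => variance
              (fun z => (∫⁻ s in Icc 0 t, ENNReal.ofReal (frac K ((Φ N).flow s z))).toReal)
              (localGibbsLaw σ a₀ u₀ θ₀ N (Φ N))) atTop (𝓝 0) :=
  fun h => occupationVariance_of_fixedTimeTailVariance (fixedTimeTailVariance_of_maxwellianOneBodyInBand h)

/-- **THE DOCK OF THE REGISTERED STUB 6 `stub_pairDecorrelation` (r3 text VERBATIM as conclusion).**
`AnosovDiceHopf.MaxwellianOneBodyInBand` (stmt-AtomisticToContinuum-17603) implies, under the crux prefix, the pair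
decorrelation `E_{P_N}[ζ₀ζ₁] − E_{P_N}[ζ₀]E_{P_N}[ζ₁] → 0` of the time-integrated tail sojourns of the two tagged
spheres `0, 1`, for every level `K`: the variance dock `occupationVariance_of_maxwellianOneBodyInBand` followed by
the landed exchangeability converse `pairDecorrelation_of_occupationVariance` (`|Cov(ζ₀,ζ₁)| ≤ 2 Var occ_K + t²/(4N)`,
file `…MesoPairDecorrelationGlue.lean`). -/
theorem pairDecorrelation_of_maxwellianOneBodyInBand :
    Summit.AtomisticToContinuum.HydrodynamicLimit.Theses.AnosovDiceHopf.MaxwellianOneBodyInBand →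
    ∀ (a₀ θ₀ : T3 → ℝ) (u₀ : T3 → V3), Continuous a₀ → Continuous θ₀ → Continuous u₀ →
      (∀ x, 0 < a₀ x) → (∀ x, 0 < θ₀ x) →
      ∃ σ₀ : ℝ, 0 < σ₀ ∧ ∃ η₁ : ℝ, 0 < η₁ ∧ ∀ σ : ℝ, 0 < σ → σ < σ₀ →
        ∀ (T : ℝ) (ρ θ : ℝ → T3 → ℝ) (u : ℝ → T3 → V3), IsHardSphereEulerSolution σ T ρ u θ →
        ∀ Φ : (N : ℕ) → HardSphereFlow (Torus.geometry (Fin 3)) (hsDiameter σ N) (N + 1),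
          TendstoHydroFieldsAt (fun N => localGibbsLaw σ a₀ u₀ θ₀ N (Φ N)) Φ ρ u θ 0 →
          ∀ t : ℝ, 0 < t → t < T → (∀ s ∈ Icc 0 t, ∀ x, 2 * ρ s x * σ ^ 3 < η₁) →
            ∀ K : ℝ, Tendsto (fun N : ℕ =>
              (∫ z, (∫⁻ s in Icc 0 t, ENNReal.ofReal (if K ≤ ‖((Φ N).flow s z 0).2‖ ^ 2 then (1 : ℝ) else 0)).toReal *
                  (∫⁻ s in Icc 0 t, ENNReal.ofReal (if K ≤ ‖((Φ N).flow s z 1).2‖ ^ 2 then (1 : ℝ) else 0)).toReal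
                  ∂(localGibbsLaw σ a₀ u₀ θ₀ N (Φ N))) -
                (∫ z, (∫⁻ s in Icc 0 t, ENNReal.ofReal (if K ≤ ‖((Φ N).flow s z 0).2‖ ^ 2 then (1 : ℝ) else 0)).toReal
                  ∂(localGibbsLaw σ a₀ u₀ θ₀ N (Φ N))) *
                (∫ z, (∫⁻ s in Icc 0 t, ENNReal.ofReal (if K ≤ ‖((Φ N).flow s z 1).2‖ ^ 2 then (1 : ℝ) else 0)).toReal
                  ∂(localGibbsLaw σ a₀ u₀ θ₀ N (Φ N)))) atTop (𝓝 0) := by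
  intro h17603 a₀ θ₀ u₀ ha hθ hu ha0 hθ0
  obtain ⟨σ₀, hσ₀, η₁, hη₁, hvar⟩ :=
    occupationVariance_of_maxwellianOneBodyInBand h17603 a₀ θ₀ u₀ ha hθ hu ha0 hθ0
  refine ⟨min σ₀ (1 / 2), lt_min hσ₀ one_half_pos, η₁, hη₁, ?_⟩
  intro σ hσ hσlt T ρ θ u hsol Φ h0 t ht htT hchamber K
  exact pairDecorrelation_of_occupationVariance ⟨ha, hθ, hu, ha0, hθ0⟩ (hσlt.trans_le (min_le_right _ _)).le Φ
    ht.le K (hvar σ hσ (hσlt.trans_le (min_le_left _ _)) T ρ θ u hsol Φ h0 t ht htT hchamber K)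

end Summit.AtomisticToContinuum.HydrodynamicLimit.Theorems.MesoChebyshevWindow

end
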